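import Summits.AtomisticToContinuum.Crystallization.Theorems.FrustratedLawDichotomyStrainedPatchHomEntryLeafHTA2Q
import Summits.AtomisticToContinuum.Crystallization.Theorems.FrustratedLawDichotomyStrainedPatchHomSlopeLJAffine2Pieces

/-!
# The component-certified certificate side `htCertSideA2Q` from SEPARATE KERNEL FACTS (each under the farm's 600 s)
# (27623 `(H) HomFloor (1/625)`, hcp half; hand-1 g34 FINDING §3b)

decomp-a2c hand-1 g34 (crux `AperiodicFrustratedLawGap`, stmt-AtomisticToContinuum-27623).  ★ `htCertSideA2Q_of_parts`: `htCertRestA2 p J c w` (the first-order-type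
conjuncts, ≈ 77 s) + the three quadratic-component facts `quadVec2F … i ≤ Q i` (each ≈ 90 s on the tabulated form via `…Affine2QKit.quadVec2R_eq`) + the linear-pieces
fact `g0 + lin + ⌈√ΣQ²⌉ + rem3 + nai ≤ Gn` (≈ 150 s) + `Gn + far₁ + far₂ ≤ p.Gs` (≈ 40 s) ⟹ `htCertSideA2Q p Q Gn J c w = true`.  (`htScA2Q = htScA2F`,
`htSnA2Q = htSnA2F` definitionally.)

NO new definitions besides two `rfl` abbreviation lemmas; 0 sorry; standard axioms.  `--supports stmt-AtomisticToContinuum-27623`.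
-/

namespace Summit.AtomisticToContinuum.Crystallization.Theorems.FrustratedLawDichotomyStrainedPatchHomEntryLeafHT

open Literature.Analysis.ValidatedNumerics.Numerics
open Summit.AtomisticToContinuum.Crystallization.Theorems.FrustratedLawDichotomyStrainedPatchHomCurvLJ (ljLabelOK naiveLJ)
open Summit.AtomisticToContinuum.Crystallization.Theorems.FrustratedLawDichotomyStrainedPatchHomSlopeLJ
open Summit.AtomisticToContinuum.Crystallization.Theorems.FrustratedLawDichotomyStrainedPatchHomSlopeLJAffine
open Summit.AtomisticToContinuum.Crystallization.Theorems.FrustratedLawDichotomyStrainedPatchHomSlopeLJAffine2Kit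

/-- `htScA2Q = htScA2F`. [formal bookkeeping] -/
theorem htScA2Q_eq (c w : (Fin 3 × Fin 3) ⊕ Fin 3 → ℤ) (J : Fin 3 → Fin 3 × Fin 3 → ℤ) (L : List (Fin 3 → ℤ)) : htScA2Q c w J L = htScA2F c w J L := rfl
/-- `htSnA2Q = htSnA2F`. [formal bookkeeping] -/
theorem htSnA2Q_eq (c w : (Fin 3 × Fin 3) ⊕ Fin 3 → ℤ) (J : Fin 3 → Fin 3 × Fin 3 → ℤ) (L : List (Fin 3 → ℤ)) : htSnA2Q c w J L = htSnA2F c w J L := rfl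

/-- ★ **THE COMPONENT-CERTIFIED CERTIFICATE SIDE FROM ITS KERNEL FACTS.** [formal bookkeeping] -/
theorem htCertSideA2Q_of_parts {p : HTCert} {Q : Fin 3 → ℤ} {Gn : ℤ} {J : Fin 3 → Fin 3 × Fin 3 → ℤ} {c w : (Fin 3 × Fin 3) ⊕ Fin 3 → ℤ}
    (h1 : htCertRestA2 p J c w = true)
    (hq0 : quadVec2F c w J (htScA2F c w J (htNearU c w)) 0 ≤ Q 0) (hq1 : quadVec2F c w J (htScA2F c w J (htNearU c w)) 1 ≤ Q 1)
    (hq2 : quadVec2F c w J (htScA2F c w J (htNearU c w)) 2 ≤ Q 2)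
    (hlin : g0LJ c (htScA2F c w J (htNearU c w)) + linLJA c w J (htScA2F c w J (htNearU c w)) + sqrtQ Q +
      rem3LJ c (hullW J w) (htScA2F c w J (htNearU c w)) + naiSLJ c (hullW J w) (htSnA2F c w J (htNearU c w)) ≤ Gn)
    (hfar : Gn + htGsNA c w J (htFar1U c w) + htGsNA c w J (htFar2U c w) ≤ p.Gs) : htCertSideA2Q p Q Gn J c w = true := by
  unfold htCertRestA2 at h1
  simp only [Bool.and_eq_true] at h1
  obtain ⟨⟨⟨⟨⟨⟨⟨hball, hjac⟩, hROK⟩, hcert⟩, hcurvM⟩, hfar1⟩, hfar2⟩, ⟨⟨hs1, hs2⟩, hs3⟩⟩ := h1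
  have hguard : (htScA2F c w J (htNearU c w)).all (fun b => ljLabelOK c (hullW J w) b) = true := all_filter_self _ _
  unfold htNaiOKA2F at hs1
  unfold htCertSideA2Q htNearOKA2Q slopeCheckLJA2Q
  simp only [htScA2Q_eq, htSnA2Q_eq, Bool.and_eq_true, decide_eq_true_eq]
  simp only [hball, hjac, hROK, hcert, hcurvM, hfar1, hfar2, hguard, hs1, hs2, hs3, hq0, hq1, hq2, hlin, hfar, and_self]

end Summit.AtomisticToContinuum.Crystallization.Theorems.FrustratedLawDichotomyStrainedPatchHomEntryLeafHT
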